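/-
Copyright (c) 2026 the pub-hodgecm-mathlib formalisation cell (harness21).  Prover seat hodgecm-mathlib-K2E1-p11 (g6), Track B ∕ K2-LIT, h413 = `stmt-HodgeConjecture-24833`,
R90-TF section S8 «ContSpec-n½», the `hsrc` supplier estate, census `R90/S8/CENSUS-UnfoldingLetterFree.K2E1-p11-g6.md` f7bfa6fc755d5846 item (b)′ «`hbox`» (S8 dealer R90-CS-plan (g3),
S8-R240 (2) ∕ S8-R250): THE VALUATION BALL OF THE LEVEL LIES IN `𝒪_v³` once the level absorbs `2δ` — the local letter `hbox` of ★ p865059 `badPlace_hread_of_indicator`.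
-/
import Summits.HodgeConjecture.HodgeConjecture.Theorems.K2E1ChiBadPlaceReadingU3   -- ★ p865059 (this seat): the `hbox` binder's bytes; brings `integralBox`, `idealRadius`, `quadraticLocalEquiv`, `toLocalRing`, `conjLocal`
import HarnessLib

/-!
# K2·E1 ∕ R90·S8 — `K2E1ChiLevelBallInBoxU3`: THE LEVEL BALL `{p : |Ψ_v(p₀,p₁)_w|, |(σΨ_v)_w|, |(ι_v(p₂)δ − ι_v(½)Ψ_vσΨ_v)_w| ≤ |𝔫|_w}` LIES IN `𝒪_v³` WHEN `|𝔫|_w ≤ |2|_w` AND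
# `|𝔫|_w ≤ |2|_w·|δ|_w` — the letter `hbox` of ★ p865059, discharged

Cell `pub/hodgecm-mathlib`, crux h413 = `stmt-HodgeConjecture-24833`, route of record `HCCMUnconditional`; R90-TF section S8 «ContSpec-n½», road R2-χ₃ ((V)∕(R)′ OF RECORD row `hsrc`; ★
p864821's `hωS₀` indicator is `𝟙{p ∈ 𝒪_v³ ∧ ball(p)}` while the finite witness's weight at a place of `S₀` is `𝟙{ball(p)}` (★ p865059): they agree iff `ball ⊆ 𝒪_v³`).  THEOREMS ONLY (no
`def`, no `instance`, no `notation`, no named-fact hypothesis, no `sorry`; default heartbeats); lane `--supports stmt-HodgeConjecture-24833 --as helper` (count-neutral).  Closes no socket.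

THE MATHEMATICS ([CasselsFrohlichANT1967] Ch. II §§10–11; [Rogawski1990] §4.5 p. 45; [BushnellHenniart2006] §12.4).  `v` a finite place of `L⁺`, `w ∣ v` a place of the CM field `L`
(ramification index `e ≥ 1`: `|ι_w a|_w = |a|_v^e`, ★ `valued_toPlace`), `δ ∈ L⁻ ∖ 0`, `X = Ψ_v(a, b) = ι a + ι b·δ`, `σX = ι a − ι b·δ` (★ `conjLocal_quadraticLocalEquiv`),
`Z = ι t·δ − ι(½)·X·σX`.  If `|X_w|, |σX_w|, |Z_w| ≤ r` with `r ≤ |2|_w` and `r ≤ |2|_w·|δ|_w` (and `r ≤ 1`, automatic for `r = |𝔫|_w`), then `|ι(2a)|_w = |X + σX|_w ≤ r ≤ |2|_w` gives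
`|ι a|_w ≤ 1`; `|ι(2b)·δ|_w = |X − σX|_w ≤ r ≤ |2|_w|δ|_w` gives `|ι b|_w ≤ 1`; `|2|·|ι t|·|δ| = |2Z + XσX| ≤ max(|2|r, r²) ≤ |2||δ|` gives `|ι t|_w ≤ 1` — so `a, b, t ∈ 𝒪_v`.  Hence at a
place of `S₀` where the level of record satisfies `|𝔫|_w ≤ |2|_w` and `|𝔫|_w ≤ |2δ|_w` for some `w ∣ v`, the `hbox` letter of ★ p865059 holds: the (V) keeper's `𝔫` absorbs `2δ·∏_{S₀}𝔭_w`.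
* §1 `le_one_of_mul_le` (valuation bookkeeping), `mem_adicCompletionIntegers_of_valued_toLocalRing_le_one` (`|ι_w a|_w ≤ 1 ⇒ a ∈ 𝒪_v`).
* §2 HEAD **`mem_integralBox_of_levelBall`** — the ball lies in `𝒪_v³`; **`hbox_of_level`** — ★ p865059's `hbox` binder BYTE FOR BYTE at `r = |𝔫|_w` under `|𝔫|_w ≤ |2|_w`, `|𝔫|_w ≤ |2|_w|δ|_w`.
HONEST LABEL: HC_CM is proved only modulo the 7 printed citations (2 remaining named inputs: hLiu418 = `stmt-HodgeConjecture-24832`, h413 = `stmt-HodgeConjecture-24833`) until rung 0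
closes; REL ≠ ★ ≠ BUILT; unconditional local valuation algebra; asserts no named fact, closes no socket; count-neutral.

## References
* [CasselsFrohlichANT1967] J. W. S. Cassels, A. Fröhlich (eds.), *Algebraic Number Theory* (1967), Ch. II §§10–11.
* [Rogawski1990] J. D. Rogawski, *Automorphic Representations of Unitary Groups in Three Variables*, Ann. of Math. Stud. 123 (1990), §4.5 p. 45.
* [BushnellHenniart2006] C. J. Bushnell, G. Henniart, *The Local Langlands Conjecture for GL(2)* (2006), §12.4.
-/

set_option autoImplicit false
set_option linter.dupNamespace false  -- the mandated namespace repeats the summit's segment (`HodgeConjecture.HodgeConjecture`)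

noncomputable section

open NumberField IsDedekindDomain Filter Set Function
open Literature.NumberTheory.Automorphic Literature.NumberTheory.Automorphic.UnitaryGroup

namespace Summit.HodgeConjecture.HodgeConjecture.Cruxes.H413.K2E1ChiLevelBallInBoxU3

/-! ## §1 Valuation bookkeeping -/

/-- In a linearly ordered commutative group with zero: `y·c ≤ c` with `c ≠ 0` forces `y ≤ 1`. [folklore] -/
theorem le_one_of_mul_le {Γ₀ : Type*} [LinearOrderedCommGroupWithZero Γ₀] {y c : Γ₀} (hc : c ≠ 0) (h : y * c ≤ c) : y ≤ 1 := by
  by_contra hy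
  have h1 : 1 * c < y * c := mul_lt_mul_of_pos_right (not_le.1 hy) (zero_lt_iff.2 hc)
  rw [one_mul] at h1
  exact absurd h (not_le.2 h1)

variable (L : Type) [Field L] [NumberField L] [IsCMField L]

omit [IsCMField L] in
/-- **Integrality descends along `ι_w : L⁺_v → L_w`**: `|ι_w a|_w ≤ 1 ⇒ a ∈ 𝒪_v` (`|ι_w a|_w = |a|_v^e`, `e ≥ 1`: ★ `valued_toPlace`, Mathlib `pow_le_one_iff`). [cite: CasselsFrohlichANT1967, Ch. II §10] -/
theorem mem_adicCompletionIntegers_of_valued_toLocalRing_le_one (v : HeightOneSpectrum (𝓞 ↥(maximalRealSubfield L))) (w : PlacesOver L v)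
    {a : v.adicCompletion ↥(maximalRealSubfield L)} (ha : Valued.v (toLocalRing L v a w) ≤ 1) :
    a ∈ v.adicCompletionIntegers ↥(maximalRealSubfield L) := by
  haveI := PlacesOver.liesOver w
  rw [HeightOneSpectrum.mem_adicCompletionIntegers]
  rw [toLocalRing_apply, valued_toPlace] at ha
  exact (pow_le_one_iff (Ideal.IsDedekindDomain.ramificationIdx'_ne_zero_of_liesOver w.1.asIdeal v.ne_bot)).1 ha

/-! ## §2 HEAD: the level ball lies in the integral box -/

/-- **THE BALL LIES IN `𝒪_v³`.**  At a finite place `v` of `L⁺` with a place `w ∣ v`, let `r ≤ |2|_w` and `r ≤ |2|_w·|δ|_w` (`r ≤ 1`).  If `p ∈ (L⁺_v)³` satisfies `|Ψ_v(p₀,p₁)_w| ≤ r`,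
`|(σΨ_v(p₀,p₁))_w| ≤ r` and `|(ι_v(p₂)δ − ι_v(½)Ψ_vσΨ_v)_w| ≤ r`, then `p ∈ 𝒪_v³` (`2ιp₀ = X + σX`, `2ιp₁δ = X − σX`, `2ιp₂δ = 2Z + XσX`). [cite: CasselsFrohlichANT1967, Ch. II §§10–11] [cite: Rogawski1990, §4.5 p. 45] -/
theorem mem_integralBox_of_levelBall {δ : L} (hcδ : IsCMField.complexConj L δ = -δ) (hδ : δ ≠ 0)
    (v : HeightOneSpectrum (𝓞 ↥(maximalRealSubfield L))) (w : PlacesOver L v)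
    {r : WithZero (Multiplicative ℤ)} (hr1 : r ≤ 1) (hr2 : r ≤ Valued.v (toLocalRing L v 2 w))
    (hrδ : r ≤ Valued.v (toLocalRing L v 2 w) * Valued.v (algebraMap L (LocalRing L v) δ w))
    (p : Fin 3 → v.adicCompletion ↥(maximalRealSubfield L))
    (hX : Valued.v (quadraticLocalEquiv L v (IsCMField.complexConj L) hcδ hδ (p 0, p 1) w) ≤ r)
    (hσX : Valued.v (conjLocal L (IsCMField.complexConj L) v (quadraticLocalEquiv L v (IsCMField.complexConj L) hcδ hδ (p 0, p 1)) w) ≤ r)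
    (hZ : Valued.v ((toLocalRing L v (p 2) * algebraMap L (LocalRing L v) δ -
      toLocalRing L v 2⁻¹ * (quadraticLocalEquiv L v (IsCMField.complexConj L) hcδ hδ (p 0, p 1) *
        conjLocal L (IsCMField.complexConj L) v (quadraticLocalEquiv L v (IsCMField.complexConj L) hcδ hδ (p 0, p 1)))) w) ≤ r) :
    p ∈ integralBox ↥(maximalRealSubfield L) (Fin 3) v := by
  haveI : Algebra.IsQuadraticExtension ↥(maximalRealSubfield L) L := IsCMField.isQuadraticExtension L
  -- abbreviations at `w`
  set a := toLocalRing L v (p 0) w with ha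
  set b := toLocalRing L v (p 1) w with hb
  set t := toLocalRing L v (p 2) w with ht
  set two := toLocalRing L v 2 w with htwo
  set dw := algebraMap L (LocalRing L v) δ w with hdw
  -- the coordinates at `w`: `X_w = a + b·δ_w`, `σX_w = a − b·δ_w`
  have hXw : quadraticLocalEquiv L v (IsCMField.complexConj L) hcδ hδ (p 0, p 1) w = a + b * dw := by
    rw [quadraticLocalEquiv_apply]; rfl
  have hσXw : conjLocal L (IsCMField.complexConj L) v (quadraticLocalEquiv L v (IsCMField.complexConj L) hcδ hδ (p 0, p 1)) w = a - b * dw := by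
    rw [conjLocal_quadraticLocalEquiv, quadraticLocalEquiv_apply, map_neg]
    show toLocalRing L v (p 0) w + (-toLocalRing L v (p 1)) w * algebraMap L (LocalRing L v) δ w = a - b * dw
    rw [Pi.neg_apply]; ring
  -- non-vanishing: `|2|_w ≠ 0`, `|δ_w| ≠ 0`
  have htwo0 : Valued.v two ≠ 0 := by
    rw [htwo, toLocalRing_apply, (Valuation.ne_zero_iff _)]
    exact (map_ne_zero _).2 two_ne_zero
  have hdw0 : Valued.v dw ≠ 0 := by
    rw [hdw, Pi.algebraMap_apply, (Valuation.ne_zero_iff _)]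
    exact (map_ne_zero _).2 hδ
  have htwo1 : Valued.v two ≤ 1 := by
    rw [htwo, toLocalRing_apply, map_ofNat, show (2 : w.1.adicCompletion L) = 1 + 1 by norm_num]
    exact (Valuation.map_add _ _ _).trans (by rw [Valuation.map_one, max_self])
  -- `2·ι½ = 1` in `∏ L_w`, read at `w`
  have hhalf : two * toLocalRing L v 2⁻¹ w = 1 := by
    rw [htwo, ← Pi.mul_apply, ← map_mul, mul_inv_cancel₀ (two_ne_zero), map_one, Pi.one_apply]
  rw [mem_integralBox_iff]
  intro i
  fin_cases i
  · -- `p₀`: `2a = X_w + σX_w`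
    refine mem_adicCompletionIntegers_of_valued_toLocalRing_le_one L v w (le_one_of_mul_le htwo0 ?_)
    have h2a : a * two = quadraticLocalEquiv L v (IsCMField.complexConj L) hcδ hδ (p 0, p 1) w +
        conjLocal L (IsCMField.complexConj L) v (quadraticLocalEquiv L v (IsCMField.complexConj L) hcδ hδ (p 0, p 1)) w := by
      rw [hXw, hσXw, htwo, toLocalRing_apply, map_ofNat]; ring
    show Valued.v a * Valued.v two ≤ Valued.v two
    rw [← Valuation.map_mul, h2a]
    exact ((Valuation.map_add _ _ _).trans (max_le hX hσX)).trans hr2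
  · -- `p₁`: `2bδ = X_w − σX_w`
    refine mem_adicCompletionIntegers_of_valued_toLocalRing_le_one L v w (le_one_of_mul_le (mul_ne_zero htwo0 hdw0) ?_)
    have h2b : b * (two * dw) = quadraticLocalEquiv L v (IsCMField.complexConj L) hcδ hδ (p 0, p 1) w -
        conjLocal L (IsCMField.complexConj L) v (quadraticLocalEquiv L v (IsCMField.complexConj L) hcδ hδ (p 0, p 1)) w := by
      rw [hXw, hσXw, htwo, toLocalRing_apply, map_ofNat]; ring
    show Valued.v b * (Valued.v two * Valued.v dw) ≤ Valued.v two * Valued.v dw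
    rw [show Valued.v b * (Valued.v two * Valued.v dw) = Valued.v (b * (two * dw)) by rw [Valuation.map_mul, Valuation.map_mul], h2b]
    exact ((Valuation.map_sub _ _ _).trans (max_le hX hσX)).trans hrδ
  · -- `p₂`: `2ιp₂δ = 2Z + X·σX`
    refine mem_adicCompletionIntegers_of_valued_toLocalRing_le_one L v w (le_one_of_mul_le (mul_ne_zero htwo0 hdw0) ?_)
    have h2t : t * (two * dw) = two * ((toLocalRing L v (p 2) * algebraMap L (LocalRing L v) δ -
        toLocalRing L v 2⁻¹ * (quadraticLocalEquiv L v (IsCMField.complexConj L) hcδ hδ (p 0, p 1) *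
          conjLocal L (IsCMField.complexConj L) v (quadraticLocalEquiv L v (IsCMField.complexConj L) hcδ hδ (p 0, p 1)))) w) +
        quadraticLocalEquiv L v (IsCMField.complexConj L) hcδ hδ (p 0, p 1) w *
          conjLocal L (IsCMField.complexConj L) v (quadraticLocalEquiv L v (IsCMField.complexConj L) hcδ hδ (p 0, p 1)) w := by
      rw [Pi.sub_apply, Pi.mul_apply, Pi.mul_apply, Pi.mul_apply]
      linear_combination (quadraticLocalEquiv L v (IsCMField.complexConj L) hcδ hδ (p 0, p 1) w *
        conjLocal L (IsCMField.complexConj L) v (quadraticLocalEquiv L v (IsCMField.complexConj L) hcδ hδ (p 0, p 1)) w) * hhalf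
    show Valued.v t * (Valued.v two * Valued.v dw) ≤ Valued.v two * Valued.v dw
    rw [show Valued.v t * (Valued.v two * Valued.v dw) = Valued.v (t * (two * dw)) by rw [Valuation.map_mul, Valuation.map_mul], h2t]
    refine (Valuation.map_add _ _ _).trans (max_le ?_ ?_)
    · rw [Valuation.map_mul]
      calc Valued.v two * Valued.v _ ≤ Valued.v two * r := mul_le_mul' le_rfl hZ
        _ ≤ Valued.v two * (Valued.v two * Valued.v dw) := mul_le_mul' le_rfl hrδ
        _ ≤ 1 * (Valued.v two * Valued.v dw) := mul_le_mul' htwo1 le_rfl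
        _ = Valued.v two * Valued.v dw := one_mul _
    · rw [Valuation.map_mul]
      calc Valued.v _ * Valued.v _ ≤ r * r := mul_le_mul' hX hσX
        _ ≤ 1 * (Valued.v two * Valued.v dw) := mul_le_mul' hr1 hrδ
        _ = Valued.v two * Valued.v dw := one_mul _

/-- **★ p865059's LETTER `hbox`, DISCHARGED AT A LEVEL ABSORBING `2δ`**: at a finite place `v` of `L⁺` with a place `w ∣ v` at which the level of record satisfies `|𝔫|_w ≤ |2|_w` and
`|𝔫|_w ≤ |2|_w·|δ|_w`, the level ball `{p : ∀ w' ∣ v, |Ψ_v(p₀,p₁)_{w'}|, |(σΨ_v)_{w'}|, |(ι_v(p₂)δ − ι_v(½)Ψ_vσΨ_v)_{w'}| ≤ |𝔫|_{w'}}` lies in `𝒪_v³` — the binder `hbox` of ★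
`K2E1ChiBadPlaceReadingU3.badPlace_hread_of_indicator`, byte for byte. [cite: CasselsFrohlichANT1967, Ch. II §§10–11] [cite: BushnellHenniart2006, §12.4] -/
theorem hbox_of_level {δ : L} (hcδ : IsCMField.complexConj L δ = -δ) (hδ : δ ≠ 0) (𝔫 : Ideal (𝓞 L))
    (v : HeightOneSpectrum (𝓞 ↥(maximalRealSubfield L))) (w : PlacesOver L v)
    (h2 : idealRadius L w.1 𝔫 ≤ Valued.v (toLocalRing L v 2 w))
    (h2δ : idealRadius L w.1 𝔫 ≤ Valued.v (toLocalRing L v 2 w) * Valued.v (algebraMap L (LocalRing L v) δ w)) :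
    ∀ p : Fin 3 → v.adicCompletion ↥(maximalRealSubfield L), (∀ w' : PlacesOver L v,
        Valued.v (quadraticLocalEquiv L v (IsCMField.complexConj L) hcδ hδ (p 0, p 1) w') ≤ idealRadius L w'.1 𝔫 ∧
        Valued.v (conjLocal L (IsCMField.complexConj L) v (quadraticLocalEquiv L v (IsCMField.complexConj L) hcδ hδ (p 0, p 1)) w') ≤ idealRadius L w'.1 𝔫 ∧
        Valued.v ((toLocalRing L v (p 2) * algebraMap L (LocalRing L v) δ -
          toLocalRing L v 2⁻¹ * (quadraticLocalEquiv L v (IsCMField.complexConj L) hcδ hδ (p 0, p 1) * conjLocal L (IsCMField.complexConj L) v (quadraticLocalEquiv L v (IsCMField.complexConj L) hcδ hδ (p 0, p 1)))) w') ≤ idealRadius L w'.1 𝔫) →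
      p ∈ integralBox ↥(maximalRealSubfield L) (Fin 3) v :=
  fun p hp => mem_integralBox_of_levelBall L hcδ hδ v w (idealRadius_le_one L w.1 𝔫) h2 h2δ p (hp w).1 (hp w).2.1 (hp w).2.2

end Summit.HodgeConjecture.HodgeConjecture.Cruxes.H413.K2E1ChiLevelBallInBoxU3

end
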